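import Literature.AlgebraicGeometry.GroupSchemes.AffineGroupSchemeHopfAlgebraRoundTrip
import Mathlib.RingTheory.Bialgebra.Hom
import HarnessLib

/-!
# Homomorphisms of affine group schemes are the bialgebra maps of their Hopf algebras (Görtz–Wedhorn II §(27.2))

Layer `Literature/AlgebraicGeometry/GroupSchemes`, namespace `Literature.AlgebraicGeometry.GroupSchemes.AffineGroupScheme` (continues ★
`AffineGroupSchemeHopfAlgebra` p844646 — `Alg G = Γ(G, 𝒪_G)`, `ptEquiv`, `groupLaw` —, ★ `AffineGroupSchemeOfHopfAlgebra` p845155 — `coord`,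
`grpObjOfHopfAlgebra` — and ★ `AffineGroupSchemeHopfAlgebraRoundTrip` p845217 — `coord_specOverMapOfAlgHom`).  One small `def` (the bundled
bialgebra map `Alg.comapBialgHom f`) + theorems; no instance, no notation, no named fact, no `sorry`.  Cell `hodgecm-mathlib` (D-0151), programme P6
«MOD», HEART organ (g1) «scheme dress of Cartier duality», FILE 2 of the B-p04 (g37) plan (the functoriality input: `G ↦ G^D` is `Spec` of the
TRANSPOSE of the bialgebra map `Γ(f)`).  Count-neutral Mathlib-side capital: HC_CM is proved only modulo the 7 printed citations until rung 0
closes; nothing here bears on it.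

THE PRINT ([GortzWedhorn2023] §(27.2), (27.2.1) and Def. 27.6, pp. 606–607): under «affine group schemes over `R` = commutative Hopf `R`-algebras»,
HOMOMORPHISMS of group schemes `G₁ → G₂` correspond to Hopf-algebra maps `Γ(G₂) → Γ(G₁)`.  Both directions, in the tree's currency:

* §1 for AFFINE group objects `G₁, G₂` of `SchemeOver R` and a homomorphism `f : G₁ ⟶ G₂` (Mathlib `IsMonHom f`): `ptEquiv_comp`
  (naturality of ★ `ptEquiv` in `G`: the algebra map of `u ≫ v` is `(alg. map of u) ∘ Γ(v)`), `groupLaw_mul_comp_comap ∕ _one_ ∕ _inv_`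
  (`Γ(f) = Alg.comap f` intertwines the functorial group laws), **`counitAlgHom_comp_comap`** (`ε₁ ∘ Γ(f) = ε₂`), **`map_comap_comp_comulAlgHom`**
  (`(Γ(f) ⊗ Γ(f)) ∘ Δ₂ = Δ₁ ∘ Γ(f)`), HEAD **`Alg.comapBialgHom f : Alg G₂ →ₐc[R] Alg G₁`**, and **`comap_antipode`** (`Γ(f) ∘ S₂ = S₁ ∘ Γ(f)`);
* §2 conversely, for commutative Hopf algebras `H₁, H₂` and a BIALGEBRA map `ψ : H₂ →ₐc[R] H₁`: `coord_comp_specOverMapOfAlgHom`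
  (`coord (g ≫ Spec ψ) = coord g ∘ ψ`) and HEAD **`isMonHom_specOverMapOfAlgHom`** — `Spec ψ : Spec H₁ → Spec H₂` is a homomorphism of the
  group objects `grpObjOfHopfAlgebra R H₁ ∕ H₂` (points multiply by convolution, ★ `coord_mul_eq`; a bialgebra map transports convolution,
  Mathlib `AlgHom.convMul_comp_bialgHom_distrib`).

## References
* [GortzWedhorn2023] U. Görtz, T. Wedhorn, *Algebraic Geometry II* (2023), §(27.2), (27.2.1), Def. 27.6 (pp. 606–607).
-/

set_option autoImplicit false

-- Mathlib's `Over`/`Scheme` APIs are stated across semireducible wrappers (as in the ★ `GroupSchemes/*` files).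
set_option backward.isDefEq.respectTransparency false

universe u

open CategoryTheory CategoryTheory.Limits AlgebraicGeometry MonoidalCategory CartesianMonoidalCategory TensorProduct WithConv

noncomputable section

namespace Literature.AlgebraicGeometry.GroupSchemes

namespace AffineGroupScheme

open scoped MonObj

open Literature.AlgebraicGeometry.Motives Literature.NumberTheory.DiophantineGeometry

variable {R : Type u} [CommRing R]

/-! ## §1 `Γ(f)` is a bialgebra map for a homomorphism `f : G₁ ⟶ G₂` of affine group schemes -/

section Comap

variable {G₁ G₂ : SchemeOver R} [IsAffine G₁.left] [IsAffine G₂.left] {R' : Type u} [CommRing R'] [Algebra R R']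

/-- **The algebra map of a composite point** `u ≫ v` (affine `G₁`, `G₂` over `R`): `(alg. map of u ≫ v)(y) = (alg. map of u)(Γ(v)(y))`
(naturality of `X ≅ Spec Γ(X)`; a private copy of ★ `ptEquiv_comp_apply` of `BTGroupConnectedDimOneCoordinates`, kept local to avoid the import).
[cite: GortzWedhorn2023, §(27.2) (p. 606)] -/
private theorem ptEquiv_comp_apply' (u : specOver R R' ⟶ G₁) (v : G₁ ⟶ G₂) (y : Alg G₂) :
    ptEquiv G₂ R' (u ≫ v) y = ptEquiv G₁ R' u (v.left.appTop.hom y) := by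
  have h : CommRingCat.ofHom (ptEquiv G₂ R' (u ≫ v)).toRingHom = v.left.appTop ≫ CommRingCat.ofHom (ptEquiv G₁ R' u).toRingHom := by
    rw [ofHom_ptEquiv, ofHom_ptEquiv]
    apply Spec.map_injective
    rw [Spec.map_preimage, Spec.map_comp, Spec.map_preimage, Over.comp_left, Category.assoc, Category.assoc,
      Scheme.isoSpec_hom_naturality]
  exact congrArg (fun φ : CommRingCat.of (Alg G₂) ⟶ CommRingCat.of R' => φ.hom y) h

/-- **Naturality of `ptEquiv` in the scheme**: the algebra map of `u ≫ v` is `(alg. map of u) ∘ Γ(v)`, with `Γ(v) = Alg.comap v` (★ p845155).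
[cite: GortzWedhorn2023, §(27.2) (p. 606)] -/
theorem ptEquiv_comp (u : specOver R R' ⟶ G₁) (v : G₁ ⟶ G₂) : ptEquiv G₂ R' (u ≫ v) = (ptEquiv G₁ R' u).comp (Alg.comap v) :=
  AlgHom.ext (ptEquiv_comp_apply' u v)

variable [GrpObj G₁] [GrpObj G₂] (f : G₁ ⟶ G₂) [IsMonHom f]

/-- **`Γ(f)` intertwines the products of points**: `(φ · χ) ∘ Γ(f) = (φ ∘ Γ(f)) · (χ ∘ Γ(f))` for the functorial group laws of `G₁`, `G₂`
(Mathlib `MonObj.mul_comp`: `(u · v) ≫ f = (u ≫ f) · (v ≫ f)` for a homomorphism `f`). [cite: GortzWedhorn2023, §(27.2) (27.2.1) (pp. 606–607)] -/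
theorem groupLaw_mul_comp_comap (φ χ : Alg G₁ →ₐ[R] R') :
    ((groupLaw G₁).mul φ χ).comp (Alg.comap f) = (groupLaw G₂).mul (φ.comp (Alg.comap f)) (χ.comp (Alg.comap f)) := by
  obtain ⟨u, rfl⟩ := (ptEquiv G₁ R').surjective φ
  obtain ⟨v, rfl⟩ := (ptEquiv G₁ R').surjective χ
  rw [groupLaw_mul_apply, ← ptEquiv_comp, ← ptEquiv_comp, ← ptEquiv_comp, MonObj.mul_comp, groupLaw_mul_apply]

/-- **`Γ(f)` intertwines the unit points**: `1 ∘ Γ(f) = 1` (Mathlib `MonObj.one_comp`). [cite: GortzWedhorn2023, §(27.2) (27.2.1) (pp. 606–607)] -/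
theorem groupLaw_one_comp_comap : ((groupLaw G₁).one R').comp (Alg.comap f) = (groupLaw G₂).one R' := by
  rw [groupLaw_one, groupLaw_one, ← ptEquiv_comp, MonObj.one_comp]

/-- **`Γ(f)` intertwines the inverses of points**: `φ⁻¹ ∘ Γ(f) = (φ ∘ Γ(f))⁻¹` (Mathlib `GrpObj.inv_comp`).
[cite: GortzWedhorn2023, §(27.2) (27.2.1) (pp. 606–607)] -/
theorem groupLaw_inv_comp_comap (φ : Alg G₁ →ₐ[R] R') :
    ((groupLaw G₁).inv φ).comp (Alg.comap f) = (groupLaw G₂).inv (φ.comp (Alg.comap f)) := by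
  obtain ⟨u, rfl⟩ := (ptEquiv G₁ R').surjective φ
  rw [groupLaw_inv_apply, ← ptEquiv_comp, ← ptEquiv_comp, GrpObj.inv_comp, groupLaw_inv_apply]

/-- **`ε₁ ∘ Γ(f) = ε₂`**: `Γ(f)` commutes with the counits (the counit is the unit point). [cite: GortzWedhorn2023, §(27.2) (27.2.1) (pp. 606–607)] -/
theorem counitAlgHom_comp_comap :
    (Bialgebra.counitAlgHom R (Alg G₁)).comp (Alg.comap f) = Bialgebra.counitAlgHom R (Alg G₂) := by
  rw [counitAlgHom_alg_eq, counitAlgHom_alg_eq, CorepGroupLaw.counit, CorepGroupLaw.counit, groupLaw_one_comp_comap]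

/-- **`(Γ(f) ⊗ Γ(f)) ∘ Δ₂ = Δ₁ ∘ Γ(f)`**: `Γ(f)` commutes with the comultiplications (`Δ = p₁ · p₂` and `Γ(f)` intertwines the laws).
[cite: GortzWedhorn2023, §(27.2) (27.2.1) (pp. 606–607)] -/
theorem map_comap_comp_comulAlgHom :
    (Algebra.TensorProduct.map (Alg.comap f) (Alg.comap f)).comp (Bialgebra.comulAlgHom R (Alg G₂)) =
      (Bialgebra.comulAlgHom R (Alg G₁)).comp (Alg.comap f) := by
  rw [comulAlgHom_alg_eq, comulAlgHom_alg_eq, CorepGroupLaw.comul_def, CorepGroupLaw.comul_def, groupLaw_mul_comp_comap,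
    (groupLaw G₂).comp_mul, Algebra.TensorProduct.map_comp_includeLeft, Algebra.TensorProduct.map_comp_includeRight]

/-- **HEAD — `Γ(f) : Γ(G₂, 𝒪) → Γ(G₁, 𝒪)` is a map of bialgebras** for a homomorphism `f : G₁ ⟶ G₂` of affine group schemes over `R`
([GortzWedhorn2023] §(27.2): homomorphisms of affine group schemes are the Hopf-algebra maps of their coordinate rings).
[cite: GortzWedhorn2023, §(27.2) (27.2.1) and Definition 27.6 (pp. 606–607)] -/
def Alg.comapBialgHom : Alg G₂ →ₐc[R] Alg G₁ :=
  BialgHom.ofAlgHom (Alg.comap f) (counitAlgHom_comp_comap f) (map_comap_comp_comulAlgHom f)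

/-- `Alg.comapBialgHom f` is `Alg.comap f = Γ(f)` on elements. [cite: GortzWedhorn2023, §(27.2) (p. 606)] -/
theorem Alg.comapBialgHom_apply (a : Alg G₂) : Alg.comapBialgHom f a = Alg.comap f a := rfl

/-- The algebra map underlying `Alg.comapBialgHom f` is `Alg.comap f`. [cite: GortzWedhorn2023, §(27.2) (p. 606)] -/
theorem Alg.toAlgHom_comapBialgHom : (Alg.comapBialgHom f : Alg G₂ →ₐ[R] Alg G₁) = Alg.comap f := rfl

/-- **`Γ(f) ∘ S₂ = S₁ ∘ Γ(f)`**: `Γ(f)` commutes with the antipodes (the antipode is `id⁻¹`, and `Γ(f)` intertwines inverses) — so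
`Alg.comapBialgHom f` is a map of HOPF algebras. [cite: GortzWedhorn2023, §(27.2) (27.2.1) and Definition 27.6 (pp. 606–607)] -/
theorem comap_antipode (a : Alg G₂) :
    Alg.comap f (HopfAlgebra.antipode R (A := Alg G₂) a) = HopfAlgebra.antipode R (A := Alg G₁) (Alg.comap f a) := by
  have h : ((groupLaw G₁).antipodeAlgHom).comp (Alg.comap f) = (Alg.comap f).comp (groupLaw G₂).antipodeAlgHom := by
    rw [CorepGroupLaw.antipodeAlgHom, CorepGroupLaw.antipodeAlgHom, groupLaw_inv_comp_comap, AlgHom.id_comp,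
      (groupLaw G₂).comp_inv, AlgHom.comp_id]
  have h2 := congrArg (fun ψ => ψ a) h
  simp only [AlgHom.coe_comp, Function.comp_apply] at h2
  rw [antipode_alg_eq, antipode_alg_eq]
  exact h2.symm

end Comap

/-! ## §2 `Spec` of a bialgebra map is a homomorphism of group schemes -/

section SpecMap

variable {H₁ H₂ : Type u} [CommRing H₁] [Algebra R H₁] [CommRing H₂] [Algebra R H₂] {T : SchemeOver R}

/-- **`coord (g ≫ Spec ψ) = coord g ∘ ψ`**: the coordinates of a `T`-point pushed along `Spec ψ : Spec H₁ → Spec H₂` (★ `coord_comp`,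
★ `coord_specOverMapOfAlgHom`). [cite: GortzWedhorn2023, §(27.2) (p. 606)] -/
theorem coord_comp_specOverMapOfAlgHom (g : T ⟶ specOver R H₁) (ψ : H₂ →ₐ[R] H₁) :
    coord (g ≫ AlgPoints.specOverMapOfAlgHom ψ) = (coord g).comp ψ := by
  rw [coord_comp, coord_specOverMapOfAlgHom, ← AlgHom.comp_assoc]
  rfl

end SpecMap

section SpecMapHopf

variable (R) {H₁ H₂ : Type u} [CommRing H₁] [HopfAlgebra R H₁] [CommRing H₂] [HopfAlgebra R H₂] (ψ : H₂ →ₐc[R] H₁)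

/-- **HEAD — `Spec` of a bialgebra map is a homomorphism of group schemes**: for commutative Hopf algebras `H₁, H₂` over `R` and a
bialgebra map `ψ : H₂ → H₁`, the `R`-morphism `Spec ψ : Spec H₁ → Spec H₂` is a homomorphism of the group objects `grpObjOfHopfAlgebra R H₁`,
`grpObjOfHopfAlgebra R H₂` (Mathlib `IsMonHom`): on `T`-points it is `x ↦ x ∘ ψ`, which carries convolution to convolution
(Mathlib `AlgHom.convMul_comp_bialgHom_distrib`) and unit to unit (`ε₁ ∘ ψ = ε₂`). [cite: GortzWedhorn2023, §(27.2) (27.2.1) and Definition 27.6 (pp. 606–607)] -/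
theorem isMonHom_specOverMapOfAlgHom :
    letI := grpObjOfHopfAlgebra R H₁
    letI := grpObjOfHopfAlgebra R H₂
    IsMonHom (AlgPoints.specOverMapOfAlgHom (ψ : H₂ →ₐ[R] H₁)) := by
  letI := grpObjOfHopfAlgebra R H₁
  letI := grpObjOfHopfAlgebra R H₂
  refine ⟨?_, ?_⟩
  · apply coord_injective
    have h1 : η[specOver R H₁] = (1 : 𝟙_ (SchemeOver R) ⟶ specOver R H₁) := by
      rw [Hom.one_def, toUnit_unit, Category.id_comp]
    have h2 : η[specOver R H₂] = (1 : 𝟙_ (SchemeOver R) ⟶ specOver R H₂) := by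
      rw [Hom.one_def, toUnit_unit, Category.id_comp]
    rw [coord_comp_specOverMapOfAlgHom, h1, h2, coord_one_eq, coord_one_eq, AlgHom.convOne_def, AlgHom.convOne_def, ofConv_toConv,
      ofConv_toConv, AlgHom.comp_assoc, BialgHom.counitAlgHom_comp]
  · apply coord_injective
    have h1 : μ[specOver R H₁] = (fst (specOver R H₁) (specOver R H₁) * snd (specOver R H₁) (specOver R H₁)) := by
      rw [Hom.mul_def, lift_fst_snd, Category.id_comp]
    have h2 : (AlgPoints.specOverMapOfAlgHom (ψ : H₂ →ₐ[R] H₁) ⊗ₘ AlgPoints.specOverMapOfAlgHom (ψ : H₂ →ₐ[R] H₁)) ≫ μ[specOver R H₂] =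
        (fst (specOver R H₁) (specOver R H₁) ≫ AlgPoints.specOverMapOfAlgHom (ψ : H₂ →ₐ[R] H₁)) *
          (snd (specOver R H₁) (specOver R H₁) ≫ AlgPoints.specOverMapOfAlgHom (ψ : H₂ →ₐ[R] H₁)) := by
      rw [Hom.mul_def, lift_fst_comp_snd_comp]
    rw [coord_comp_specOverMapOfAlgHom, h1, h2, coord_mul_eq, coord_mul_eq, coord_comp_specOverMapOfAlgHom,
      coord_comp_specOverMapOfAlgHom, AlgHom.convMul_comp_bialgHom_distrib, ofConv_toConv, ofConv_toConv]

end SpecMapHopf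

end AffineGroupScheme

end Literature.AlgebraicGeometry.GroupSchemes

end
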